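import Mathlib
import HarnessLib
import Summits.QuantumFields.YangMills.Theorems.PencilRigidityCurvatureKernelBoundLatticeWindowTransferLemmas
import Summits.QuantumFields.YangMills.Theorems.PencilRigidityCurvatureKernelBoundTwoPointLocalBoundSemiDegenerate
import Summits.QuantumFields.YangMills.Theorems.InfraredLiouvilleStrongCouplingIRTrivial

/-!
# `CurvatureKernelBound` — the truncated lattice two-point function of the curvature VANISHES in the limit on separated
# axial balls, in the strong-coupling disc with sub-exponential renormalisation (support for stmt-QuantumFields-11687)

Crux `stmt-QuantumFields-11687` (`PencilRigidity.CurvatureKernelBound`), line `coupling-trichotomy`, sub-goal B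
`StrongCouplingTruncatedVanishing` (toward `Stub.FiniteCoupling`, strong-coupling disc).

If the torus truncated correlations of the curvature cluster exponentially, `≤ C e^{−m‖z‖}` for every coupling `|β| ≤ β'`,
every torus side `L+1` and every displacement `2‖z‖ < L+1` (sub-goal A), if eventually `|β_k| ≤ β'`, and if the plaquette
renormalisation is sub-exponential (`c_k² e^{−δ/a_k} → 0` for every `δ > 0`), then for real test functions `f 0, f 1`
supported in the balls `B̄(∓s e₀, ρ₀)`, `ρ₀ ≤ s/2`, the truncated smeared lattice two-point function
`LS₂(f 0, f 1) − LS₁(f 0) LS₁(f 1)` tends to `0`: every contributing pair of sites is at lattice distance `≥ s/a_k` (and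
`≤ 3s/a_k ≤ L_k` eventually, so within half the period), hence has covariance `≤ C e^{−m s/a_k}` (translation invariance of
the torus state: the covariance is the exactly-centred kernel, `StrongCouplingIRTrivial.TwoPoint.abs_centredKernel_le`); the
refined truncated bound (`LatticeWindow.abs_truncated_le_of_cov_le`) and the lattice point count
(`SemiDegenerate.latticeSum_le_of_tsupport_subset_closedBall'`) give `|LS₂ − LS₁LS₁| ≤ c_k² C e^{−m s/a_k} (3ρ₀)⁸ M₀ M₁ → 0`.
[folklore]
-/

noncomputable section

open scoped BigOperators Topology SchwartzMap
open MeasureTheory Filter Set Metric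
open Literature.MathematicalPhysics.QuantumLattice Literature.MathematicalPhysics.AQFT
open Literature.MathematicalPhysics.QuantumFieldTheory
open Literature.Probability.LatticeModels (Site box mem_box)
open Summit.QuantumFields.YangMills.Theorems.StrongCouplingIRTrivial.TwoPoint

namespace Summit.QuantumFields.YangMills.Theorems.CurvatureKernel

namespace StrongCouplingTruncated

/-! ## Geometry of a contributing pair of sites -/

/-- **Separation.** If `a x ∈ B̄(−s e₀, ρ₀)` and `a y ∈ B̄(s e₀, ρ₀)` with `ρ₀ ≤ s/2`, `0 < a`, then the sites are
at sup-norm distance `‖x − y‖ ≥ s / a` (time coordinates: `a x₀ ≤ −s + ρ₀`, `a y₀ ≥ s − ρ₀`). [folklore] -/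
theorem le_norm_sub_of_mem_closedBall {a s ρ₀ : ℝ} (ha : 0 < a) (hρs : ρ₀ ≤ s / 2) {x y : Site 4}
    (hx : a • siteToE x ∈ closedBall (EuclideanSpace.single (0 : Fin 4) (-s)) ρ₀)
    (hy : a • siteToE y ∈ closedBall (EuclideanSpace.single (0 : Fin 4) s) ρ₀) :
    s / a ≤ ‖x - y‖ := by
  rw [mem_closedBall, dist_eq_norm] at hx hy
  have h1 := (PiLp.norm_apply_le (a • siteToE x - EuclideanSpace.single (0 : Fin 4) (-s)) 0).trans hx
  have h2 := (PiLp.norm_apply_le (a • siteToE y - EuclideanSpace.single (0 : Fin 4) s) 0).trans hy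
  rw [PiLp.sub_apply, PiLp.smul_apply, siteToE_apply, smul_eq_mul, PiLp.single_eq_same,
    Real.norm_eq_abs] at h1 h2
  have h3 : |(((x - y) 0 : ℤ) : ℝ)| ≤ ‖x - y‖ :=
    StrongCouplingIRTrivial.LatticeSum.abs_cast_apply_le_norm (x - y) 0
  rw [Pi.sub_apply, Int.cast_sub] at h3
  have h4 : ((y 0 : ℤ) : ℝ) - ((x 0 : ℤ) : ℝ) ≤ ‖x - y‖ := by
    have := (abs_le.1 h3).1
    linarith
  have h5 : a * ((y 0 : ℤ) : ℝ) - a * ((x 0 : ℤ) : ℝ) ≤ a * ‖x - y‖ := by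
    rw [← mul_sub]
    exact mul_le_mul_of_nonneg_left h4 ha.le
  rw [div_le_iff₀' ha]
  have h1' := abs_le.1 h1
  have h2' := abs_le.1 h2
  linarith [h1'.2, h2'.1]

/-- **Confinement to a cube.** If `a x ∈ B̄(t e₀, ρ₀)` with `0 < a`, then `‖x‖ ≤ (|t| + ρ₀) / a` (sup norm on `ℤ⁴`).
[folklore] -/
theorem norm_le_of_smul_mem_closedBall {a t ρ₀ : ℝ} (ha : 0 < a) {x : Site 4}
    (hx : a • siteToE x ∈ closedBall (EuclideanSpace.single (0 : Fin 4) t) ρ₀) :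
    ‖x‖ ≤ (|t| + ρ₀) / a := by
  rw [mem_closedBall, dist_eq_norm] at hx
  have hρ₀ : 0 ≤ ρ₀ := (norm_nonneg _).trans hx
  have h1 : ‖a • siteToE x‖ ≤ |t| + ρ₀ := by
    have h := norm_sub_norm_le (a • siteToE x) (EuclideanSpace.single (0 : Fin 4) t)
    rw [PiLp.norm_single, Real.norm_eq_abs] at h
    linarith
  have h2 := StrongCouplingIRTrivial.norm_le_of_mem_box (StrongCouplingIRTrivial.mem_box_of_norm_smul_le ha h1)
  exact h2.trans (Nat.floor_le (div_nonneg (by positivity) ha.le))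

end StrongCouplingTruncated

open StrongCouplingTruncated in
/-- **Sub-goal B · `StrongCouplingTruncatedVanishing`** (registered signature verbatim). See the module docstring.
[folklore] -/
theorem StrongCouplingTruncatedVanishing : open Literature.MathematicalPhysics.QuantumLattice Literature.MathematicalPhysics.AQFT Literature.MathematicalPhysics.QuantumFieldTheory in ∀ (G : Type) [Group G] [TopologicalSpace G] [IsTopologicalGroup G] [CompactSpace G] [MeasurableSpace G] [BorelSpace G] (r : LatticeRep G) (sch : SpeciesScheme (YMSpecies G)) (β' m C : ℝ), 0 < m → (∀ β : ℝ, |β| ≤ β' → ∀ (L : ℕ) (z : Literature.Probability.LatticeModels.Site 4), 2 * ‖z‖ < (L : ℝ) + 1 → |wilsonExpectation (L := L + 1) r.ρ β (toTorusObservable (L + 1) fun U => r.curvature.F U * r.curvature.F (configShift z U)) - wilsonExpectation (L := L + 1) r.ρ β (toTorusObservable (L + 1) r.curvature.F) * wilsonExpectation (L := L + 1) r.ρ β (toTorusObservable (L + 1) (r.curvature.F ∘ configShift z))| ≤ C * Real.exp (-m * ‖z‖)) → (∀ᶠ k in Filter.atTop, |sch.β k| ≤ β') → (∀ δ : ℝ,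 0 < δ → Filter.Tendsto (fun k : ℕ => sch.c r.curvature k ^ 2 * Real.exp (-(δ / sch.a k))) Filter.atTop (nhds 0)) → ∀ (s ρ₀ : ℝ), 0 < s → 0 < ρ₀ → ρ₀ ≤ s / 2 → ∀ (f : Fin 2 → SchwartzMap (EuclideanSpace ℝ (Fin 4)) ℝ) (M₀ M₁ : ℝ), tsupport ((f 0 : SchwartzMap (EuclideanSpace ℝ (Fin 4)) ℝ) : (EuclideanSpace ℝ (Fin 4)) → ℝ) ⊆ Metric.closedBall (EuclideanSpace.single (0 : Fin 4) (-s)) ρ₀ → tsupport ((f 1 : SchwartzMap (EuclideanSpace ℝ (Fin 4)) ℝ) : (EuclideanSpace ℝ (Fin 4)) → ℝ) ⊆ Metric.closedBall (EuclideanSpace.single (0 : Fin 4) s) ρ₀ → (∀ x, |f 0 x| ≤ M₀) → (∀ x, |f 1 x| ≤ M₁) → Filter.Tendsto (fun k : ℕ => latticeSchwinger r.ρ sch (fun s => s.F) k 2 (fun _ => r.curvature) f - latticeSchwinger r.ρ sch (fun s => s.F) k 1 (fun _ => r.curvature) (fun _ => f 0) * latticeSchwinger r.ρ sch (fun s =>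 s.F) k 1 (fun _ => r.curvature) (fun _ => f 1)) Filter.atTop (nhds 0) := by
  intro G _ _ _ _ _ _ r sch β' m C hm hcl hβ hc s ρ₀ hs hρ₀ hρs f M₀ M₁ h0 h1 hM₀ hM₁
  -- the constant in front of `c_k² e^{−m s/a_k}`
  set E : ℝ := max C 0 * ((3 * ρ₀) ^ 4 * M₀) * ((3 * ρ₀) ^ 4 * M₁) with hE
  -- eventually: strong coupling, fine mesh, large volume
  have hev : ∀ᶠ k in atTop, |sch.β k| ≤ β' ∧ sch.a k < ρ₀ ∧ 2 * (s + ρ₀) ≤ sch.a k * sch.L k :=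
    hβ.and (((sch.tendsto_a.eventually (gt_mem_nhds hρ₀))).and
      (sch.tendsto_L.eventually_ge_atTop (2 * (s + ρ₀))))
  -- the bound in that regime
  have hbound : ∀ k, |sch.β k| ≤ β' → sch.a k < ρ₀ → 2 * (s + ρ₀) ≤ sch.a k * sch.L k →
      |latticeSchwinger r.ρ sch (fun s => s.F) k 2 (fun _ => r.curvature) f -
          latticeSchwinger r.ρ sch (fun s => s.F) k 1 (fun _ => r.curvature) (fun _ => f 0) *
            latticeSchwinger r.ρ sch (fun s => s.F) k 1 (fun _ => r.curvature) (fun _ => f 1)| ≤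
        (sch.c r.curvature k ^ 2 * Real.exp (-(m * s / sch.a k))) * E := by
    intro k hβk hak hLk
    have ha := sch.a_pos k
    -- the torus Wilson state at step `k`
    haveI : IsProbabilityMeasure
        (wilsonMeasure r.ρ (sch.β k) : MeasureTheory.Measure (GaugeConfig 4 (sch.side k) G)) :=
      isProbabilityMeasure_wilsonMeasure (d := 4) (L := sch.side k) r.ρ r.continuous (sch.β k)
    set μ := wilsonMeasure (d := 4) (L := sch.side k) r.ρ (sch.β k) with hμ
    set X : Site 4 → GaugeConfig 4 (sch.side k) G → ℝ :=
      fun x U => r.curvature.F (configShift (-x) (torusLift (sch.side k) U)) with hX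
    obtain ⟨B, hB⟩ := r.curvature.bounded
    have hXmeas : ∀ x, AEStronglyMeasurable (X x) μ := fun x =>
      (r.curvature.measurable.comp ((configShift (-x)).measurable.comp
        (measurable_torusLift (sch.side k)))).aestronglyMeasurable
    have hIX : ∀ x, Integrable (X x) μ := fun x =>
      Integrable.of_bound (hXmeas x) B (ae_of_all _ fun U => by rw [Real.norm_eq_abs]; exact hB _)
    have hIXX : ∀ x y, Integrable (fun U => X x U * X y U) μ := fun x y =>
      (hIX x).mul_bdd (hXmeas y) (c := B) (ae_of_all _ fun U => by rw [Real.norm_eq_abs]; exact hB _)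
    -- the exact mean; translation invariance of the torus state
    set q : ℝ := wilsonExpectation (L := sch.side k) r.ρ (sch.β k)
      (toTorusObservable (sch.side k) r.curvature.F) with hq
    have hEX : ∀ x, ∫ U, X x U ∂μ = q := by
      intro x
      have h := wilsonExpectation_comp_torusConfigShift (d := 4) (L := sch.side k) r.ρ (sch.β k)
        (Literature.Probability.LatticeModels.Torus.proj (sch.side k) (-x))
        (toTorusObservable (sch.side k) r.curvature.F)
      rw [← toTorusObservable_comp_configShift] at h
      exact h
    -- the covariance is the exactly-centred kernel
    have hcov : ∀ x y, ∫ U, X x U * X y U ∂μ - (∫ U, X x U ∂μ) * (∫ U, X y U ∂μ) =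
        centredKernel r.ρ (sch.β k) (2 * sch.L k + 1) r.curvature.F r.curvature.F q q x y := by
      intro x y
      rw [← LatticeWindow.cov_sub_const_eq μ (hIX x) (hIX y) (hIXX x y) q q]
      have hzero : ∫ U, (X x U - q) ∂μ = 0 := by
        rw [integral_sub (hIX x) (integrable_const _), integral_const, probReal_univ, one_smul, hEX x,
          sub_self]
      rw [hzero, zero_mul, sub_zero]
      rfl
    -- per-pair renormalised covariance bound on contributing pairs
    have hD : ∀ x ∈ box 4 (sch.L k), ∀ y ∈ box 4 (sch.L k),
        f 0 (sch.a k • siteToE x) ≠ 0 → f 1 (sch.a k • siteToE y) ≠ 0 →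
          (sch.c r.curvature k) ^ 2 *
            |(∫ U, X x U * X y U ∂μ) - (∫ U, X x U ∂μ) * (∫ U, X y U ∂μ)| ≤
            sch.c r.curvature k ^ 2 * (max C 0 * Real.exp (-(m * s / sch.a k))) := by
      intro x _ y _ hx hy
      have hxB : sch.a k • siteToE x ∈ closedBall (EuclideanSpace.single (0 : Fin 4) (-s)) ρ₀ :=
        h0 (subset_tsupport _ hx)
      have hyB : sch.a k • siteToE y ∈ closedBall (EuclideanSpace.single (0 : Fin 4) s) ρ₀ :=
        h1 (subset_tsupport _ hy)
      have hlow : s / sch.a k ≤ ‖x - y‖ := le_norm_sub_of_mem_closedBall ha hρs hxB hyB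
      have hxy : ‖x - y‖ ≤ sch.L k := by
        have h1' := norm_le_of_smul_mem_closedBall ha hxB
        have h2' := norm_le_of_smul_mem_closedBall ha hyB
        rw [abs_neg] at h1'
        rw [abs_of_pos hs] at h1' h2'
        have h3 : ‖x - y‖ ≤ ‖x‖ + ‖y‖ := norm_sub_le x y
        have h4 : (s + ρ₀) / sch.a k + (s + ρ₀) / sch.a k ≤ sch.L k := by
          rw [← add_div, div_le_iff₀' ha]
          linarith
        linarith
      refine mul_le_mul_of_nonneg_left ?_ (sq_nonneg _)
      rw [hcov]
      calc |centredKernel r.ρ (sch.β k) (2 * sch.L k + 1) r.curvature.F r.curvature.F q q x y|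
          ≤ C * Real.exp (-(m * ‖x - y‖)) :=
            abs_centredKernel_le r.ρ r.continuous r.curvature.measurable r.curvature.measurable
              r.curvature.bounded r.curvature.bounded (hcl (sch.β k) hβk) (sch.L k) rfl rfl hxy
        _ ≤ max C 0 * Real.exp (-(m * ‖x - y‖)) :=
            mul_le_mul_of_nonneg_right (le_max_left _ _) (Real.exp_nonneg _)
        _ ≤ max C 0 * Real.exp (-(m * s / sch.a k)) := by
            refine mul_le_mul_of_nonneg_left (Real.exp_le_exp.2 ?_) (le_max_right _ _)
            rw [neg_le_neg_iff, mul_div_assoc]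
            exact mul_le_mul_of_nonneg_left hlow hm.le
    -- the refined truncated bound and the lattice point count
    have hT := LatticeWindow.abs_truncated_le_of_cov_le r sch r.curvature k f hD
    have hR0 := SemiDegenerate.latticeSum_le_of_tsupport_subset_closedBall' h0 hM₀ ha hak.le (sch.L k)
    have hR1 := SemiDegenerate.latticeSum_le_of_tsupport_subset_closedBall' h1 hM₁ ha hak.le (sch.L k)
    have hD0 : 0 ≤ sch.c r.curvature k ^ 2 * (max C 0 * Real.exp (-(m * s / sch.a k))) := by positivity
    have hR0' : 0 ≤ sch.a k ^ 4 * ∑ x ∈ box 4 (sch.L k), |f 0 (sch.a k • siteToE x)| := by positivity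
    have hR1' : 0 ≤ sch.a k ^ 4 * ∑ x ∈ box 4 (sch.L k), |f 1 (sch.a k • siteToE x)| := by positivity
    calc |latticeSchwinger r.ρ sch (fun s => s.F) k 2 (fun _ => r.curvature) f -
          latticeSchwinger r.ρ sch (fun s => s.F) k 1 (fun _ => r.curvature) (fun _ => f 0) *
            latticeSchwinger r.ρ sch (fun s => s.F) k 1 (fun _ => r.curvature) (fun _ => f 1)|
        ≤ sch.c r.curvature k ^ 2 * (max C 0 * Real.exp (-(m * s / sch.a k))) *
            (sch.a k ^ 4 * ∑ x ∈ box 4 (sch.L k), |f 0 (sch.a k • siteToE x)|) *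
            (sch.a k ^ 4 * ∑ x ∈ box 4 (sch.L k), |f 1 (sch.a k • siteToE x)|) := hT
      _ ≤ sch.c r.curvature k ^ 2 * (max C 0 * Real.exp (-(m * s / sch.a k))) *
            ((3 * ρ₀) ^ 4 * M₀) * ((3 * ρ₀) ^ 4 * M₁) :=
          mul_le_mul (mul_le_mul_of_nonneg_left hR0 hD0) hR1 hR1' (mul_nonneg hD0 (hR0'.trans hR0))
      _ = (sch.c r.curvature k ^ 2 * Real.exp (-(m * s / sch.a k))) * E := by rw [hE]; ring
  -- conclude: `c_k² e^{−(m s)/a_k} · E → 0`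
  have hlim := (hc (m * s) (mul_pos hm hs)).mul_const E
  rw [zero_mul] at hlim
  refine squeeze_zero_norm' (hev.mono fun k hk => ?_) hlim
  rw [Real.norm_eq_abs]
  exact hbound k hk.1 hk.2.1 hk.2.2

end Summit.QuantumFields.YangMills.Theorems.CurvatureKernel

end
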